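import Summits.NavierStokesRegularity.NavierStokesRegularity.Theorems.EulerZoomLiouvillePowerGaugeEulerLiouvilleProfileEnergyTools

/-!
# Spiral (O(3)-twisted) self-similar profiles: the tested energy identity at a fixed mollification level
# (crux `EulerZoomLiouville.PowerGaugeEulerLiouville` = stmt-NavierStokesRegularity-19832; line `relative_equilibria`, brick R3a-P7, file 1/2)

Route `EulerZoomLiouville` (NavierStokesRegularity); width seat ns-ezl-w3 g9, LEAD 19832 ns-typeII-p2 g17 KEY «R3a-P7» (2026-08-29
14:00Z); recipe ns-idea-11 g11/g12 `Cruxes/PowerGaugeEulerLiouville/Lines/relative-equilibria.md` l.106–153, brick P7.  `--supports` stmt-19832.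

This is `ProfileEnergy.integral_integrandN_eq_zero` (`…ProfileEnergyFixedN.lean`, the untwisted brick) with the TWO LINEAR TERMS of
the spiral (Perelman) ansatz threaded through.  The spiral profile system `(1−γ)V − SV + DV[γy + Sy + V] + ∇P = 0`, `div V = 0`
(`S : ℝ³ →L ℝ³` with `tr S = 0`, e.g. skew) has the weak form — the hypothesis `heq` below, the output shape of brick P6 —
`∫ ⟪V,(V·∇)ψ⟫ + P div ψ + γ⟪V,(y·∇)ψ⟫ + ⟪V,(Sy·∇)ψ⟫ + (4γ−1)⟪V,ψ⟫ + ⟪SV,ψ⟫ = 0` for all `ψ ∈ C_c^∞(ℝ³;ℝ³)` (`div(Sy) = tr S = 0`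
keeps the coefficient `4γ − 1`).  `Spiral.integral_integrandN_eq_zero`: for a test function `σ` supported in `S₀`, a smooth field `W`
divergence free on `S₀`, the identities (E_S) `heq` tested with `ψ = σW`, (S) the weak divergence-free identity tested with
`½σ|W|²`, (D) the divergence theorem for `½σ|W|²·y` and (D_S) the divergence theorem for `½σ|W|²·(Sy)` (zero right-hand side since
`div(S·) = tr S = 0`) combine into `∫ Iₙ^S = 0` for the explicit fixed-level integrand `Iₙ^S = Iₙ + [Dσ(Sy)⟪V,W⟫ + σ⟪V,DW(Sy)⟫ + σ⟪SV,W⟫]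
− [½Dσ(Sy)|W|² + σ⟪W,DW(Sy)⟫]`, which is integrable.  File 2 (`…SpiralProfileEnergyEquality`) passes to the limit exactly as the
untwisted chain and obtains the spiral local energy equality `(2−5γ)∫σ|V|² = ∫(|V|²+2P)⟪V,∇σ⟫ + γ∫|V|²⟪y,∇σ⟫ + ∫|V|²⟪Sy,∇σ⟫
+ 2∫σ⟪SV,V⟫`, whose two S-terms vanish for skew `S` and radial-gradient `σ` — R3a\'s radial LEE clause.

WHAT THIS IS NOT: not NS regularity, not the crux — a port of a C1 tool to the spiral stratum of the MODEL-lattice crux class;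
19832 OPEN. [folklore; cf. ChaeShvydkoy2013 §2.2 eq. (2.9)]
-/

noncomputable section

set_option linter.dupNamespace false

open MeasureTheory Set Filter Topology Metric Function TopologicalSpace
open scoped ENNReal NNReal RealInnerProductSpace ContDiff Convolution

namespace Summit.NavierStokesRegularity.NavierStokesRegularity.Theorems.PowerGaugeEulerLiouville

open Literature.Analysis Literature.Analysis.FunctionSpaces Literature.Analysis.FluidPDE
open Summit.NavierStokesRegularity.NavierStokesRegularity.Theorems.PowerGaugeEulerLiouville.ProfileEnergy

namespace Spiral

/-! ## The identity at fixed mollification level, spiral form -/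

/-- **Velocity-testing at a fixed mollification level, SPIRAL form.**  With `σ` a test function supported in `S₀`, `W` smooth and
divergence free on `S₀`, `S : ℝ³ →L ℝ³` trace-free, the spiral weak profile equation tested with `ψ = σW`, the weak divergence-free
identity tested with `½σ|W|²` and the divergence theorem for `½σ|W|²·y` and for `½σ|W|²·(Sy)` combine to `∫ Iₙ^S = 0` for the
fixed-`n` integrand `Iₙ^S` (and `Iₙ^S` is integrable). [folklore] -/
theorem integral_integrandN_eq_zero {γ : ℝ}
    {V W : EuclideanSpace ℝ (Fin 3) → EuclideanSpace ℝ (Fin 3)} {P σ : EuclideanSpace ℝ (Fin 3) → ℝ}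
    {S₀ : Set (EuclideanSpace ℝ (Fin 3))} {R Cσ Cσ' : ℝ}
    (hVm : AEStronglyMeasurable V volume) (hPm : AEStronglyMeasurable P volume)
    (hσ : IsTestFunctionOn (⊤ : Opens (EuclideanSpace ℝ (Fin 3))) σ) (hKS : tsupport σ ⊆ S₀)
    (hxK : ∀ x ∈ tsupport σ, ‖x‖ ≤ R) (hR : 0 ≤ R) (hCσ : ∀ x, ‖σ x‖ ≤ Cσ)
    (hCσ' : ∀ x, ‖fderiv ℝ σ x‖ ≤ Cσ') (hW : ContDiff ℝ ∞ W) (hWdiv : ∀ x ∈ S₀, VectorCalculus.divergence W x = 0)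
    (hV2K : IntegrableOn (fun x => ‖V x‖ ^ 2) (tsupport σ) volume)
    (hV1K : IntegrableOn (fun x => ‖V x‖) (tsupport σ) volume)
    (hP1K : IntegrableOn (fun x => |P x|) (tsupport σ) volume)
    (hdiv : IsWeaklyDivFree V) {S : EuclideanSpace ℝ (Fin 3) →L[ℝ] EuclideanSpace ℝ (Fin 3)}
    (hS0 : LinearMap.trace ℝ (EuclideanSpace ℝ (Fin 3)) (S : EuclideanSpace ℝ (Fin 3) →ₗ[ℝ] EuclideanSpace ℝ (Fin 3)) = 0)
    (heq : ∀ ψ : EuclideanSpace ℝ (Fin 3) → EuclideanSpace ℝ (Fin 3),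
      IsTestFunctionOn (⊤ : Opens (EuclideanSpace ℝ (Fin 3))) ψ →
        ∫ x, (⟪V x, fderiv ℝ ψ x (V x)⟫ + P x * VectorCalculus.divergence ψ x +
          γ * ⟪V x, fderiv ℝ ψ x x⟫ + ⟪V x, fderiv ℝ ψ x (S x)⟫ + (4 * γ - 1) * ⟪V x, ψ x⟫ + ⟪S (V x), ψ x⟫) = 0) :
    Integrable (fun x => ((fderiv ℝ σ x) (V x) * ⟪(V x), (W x)⟫ + (σ x) * ⟪(V x), (fderiv ℝ W x) (V x)⟫ + (P x) * (fderiv ℝ σ x) (W x) +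
          γ * ((fderiv ℝ σ x) x * ⟪(V x), (W x)⟫ + (σ x) * ⟪(V x), (fderiv ℝ W x) x⟫) + (4 * γ - 1) * ((σ x) * ⟪(V x), (W x)⟫) -
          ((1 / 2 : ℝ) * ((fderiv ℝ σ x) (V x) * ‖(W x)‖ ^ 2) + (σ x) * ⟪(W x), (fderiv ℝ W x) (V x)⟫) -
          γ * ((1 / 2 : ℝ) * ((fderiv ℝ σ x) x * ‖(W x)‖ ^ 2) + (σ x) * ⟪(W x), (fderiv ℝ W x) x⟫ + 3 * ((1 / 2 : ℝ) * ((σ x) * ‖(W x)‖ ^ 2)))) +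
          (((fderiv ℝ σ x) (S x) * ⟪(V x), (W x)⟫ + (σ x) * ⟪(V x), (fderiv ℝ W x) (S x)⟫ + (σ x) * ⟪S (V x), (W x)⟫) -
            ((1 / 2 : ℝ) * ((fderiv ℝ σ x) (S x) * ‖(W x)‖ ^ 2) + (σ x) * ⟪(W x), (fderiv ℝ W x) (S x)⟫))) volume ∧
      ∫ x, ((fderiv ℝ σ x) (V x) * ⟪(V x), (W x)⟫ + (σ x) * ⟪(V x), (fderiv ℝ W x) (V x)⟫ + (P x) * (fderiv ℝ σ x) (W x) +
          γ * ((fderiv ℝ σ x) x * ⟪(V x), (W x)⟫ + (σ x) * ⟪(V x), (fderiv ℝ W x) x⟫) + (4 * γ - 1) * ((σ x) * ⟪(V x), (W x)⟫) -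
          ((1 / 2 : ℝ) * ((fderiv ℝ σ x) (V x) * ‖(W x)‖ ^ 2) + (σ x) * ⟪(W x), (fderiv ℝ W x) (V x)⟫) -
          γ * ((1 / 2 : ℝ) * ((fderiv ℝ σ x) x * ‖(W x)‖ ^ 2) + (σ x) * ⟪(W x), (fderiv ℝ W x) x⟫ + 3 * ((1 / 2 : ℝ) * ((σ x) * ‖(W x)‖ ^ 2)))) +
          (((fderiv ℝ σ x) (S x) * ⟪(V x), (W x)⟫ + (σ x) * ⟪(V x), (fderiv ℝ W x) (S x)⟫ + (σ x) * ⟪S (V x), (W x)⟫) -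
            ((1 / 2 : ℝ) * ((fderiv ℝ σ x) (S x) * ‖(W x)‖ ^ 2) + (σ x) * ⟪(W x), (fderiv ℝ W x) (S x)⟫)) = 0 := by
  -- supports and constants
  set K : Set (EuclideanSpace ℝ (Fin 3)) := tsupport σ with hKdef
  have hKc : IsCompact K := hσ.hasCompactSupport
  have hKm : MeasurableSet K := (isClosed_tsupport σ).measurableSet
  have hσK : ∀ x, x ∉ K → σ x = 0 := fun x hx => image_eq_zero_of_notMem_tsupport hx
  have hDσK : ∀ x, x ∉ K → fderiv ℝ σ x = 0 := fun x hx =>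
    notMem_support.1 fun h => hx (support_fderiv_subset ℝ h)
  have hσd : Differentiable ℝ σ := hσ.contDiff.differentiable (by simp)
  have hσc : Continuous σ := hσ.contDiff.continuous
  have hDσc : Continuous (fderiv ℝ σ) := hσ.contDiff.continuous_fderiv (by simp)
  have hCσ0 : 0 ≤ Cσ := (norm_nonneg _).trans (hCσ 0)
  have hCσ'0 : 0 ≤ Cσ' := (norm_nonneg _).trans (hCσ' 0)
  have hWd : Differentiable ℝ W := hW.differentiable (by simp)
  have hWc : Continuous W := hW.continuous
  have hDWc : Continuous (fderiv ℝ W) := hW.continuous_fderiv (by simp)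
  have hqK : IntegrableOn (fun x => ‖V x‖ ^ 2 + |P x| + ‖V x‖) K volume := (hV2K.add hP1K).add hV1K
  -- the test field `ψ = σ W` and the test function `θ = ½ σ |W|²`
  set ψ : EuclideanSpace ℝ (Fin 3) → EuclideanSpace ℝ (Fin 3) := fun x => σ x • W x with hψdef
  set θ : EuclideanSpace ℝ (Fin 3) → ℝ := fun x => (1 / 2 : ℝ) * (σ x * ‖W x‖ ^ 2) with hθdef
  have hψx : ∀ x, ψ x = σ x • W x := fun x => rfl
  have hθx : ∀ x, θ x = (1 / 2 : ℝ) * (σ x * ‖W x‖ ^ 2) := fun x => rfl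
  have hψ : IsTestFunctionOn (⊤ : Opens (EuclideanSpace ℝ (Fin 3))) ψ := isTestFunctionOn_smul hσ hW
  have hθ : IsTestFunctionOn (⊤ : Opens (EuclideanSpace ℝ (Fin 3))) θ :=
    isTestFunctionOn_half_mul_norm_sq hσ hW
  have hθd : Differentiable ℝ θ := hθ.contDiff.differentiable (by simp)
  have hθ1 : ContDiff ℝ 1 θ := hθ.contDiff.of_le (by exact_mod_cast le_top)
  have hψK : tsupport ψ ⊆ K := tsupport_smul_subset_left _ _
  have hθK : tsupport θ ⊆ K := by
    refine (tsupport_mul_subset_right).trans ((tsupport_mul_subset_left).trans le_rfl)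
  -- pointwise formulas
  have hDψ : ∀ x v, fderiv ℝ ψ x v = fderiv ℝ σ x v • W x + σ x • fderiv ℝ W x v :=
    fun x v => fderiv_smul_apply_of_differentiable hσd hWd x v
  have hdivψ : ∀ x, VectorCalculus.divergence ψ x = fderiv ℝ σ x (W x) := by
    intro x
    rw [hψdef, divergence_smul_of_differentiable hσd hWd x]
    by_cases hx : x ∈ S₀
    · rw [hWdiv x hx, mul_zero, add_zero]
    · rw [hσK x (fun h => hx (hKS h)), zero_mul, add_zero]
  have hDθ : ∀ x v, fderiv ℝ θ x v =
      (1 / 2 : ℝ) * (fderiv ℝ σ x v * ‖W x‖ ^ 2) + σ x * ⟪W x, fderiv ℝ W x v⟫ :=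
    fun x v => fderiv_half_mul_norm_sq_apply hσd hWd x v
  -- the three identities
  have e1 := heq ψ hψ
  have e2 : ∫ x, fderiv ℝ θ x (V x) = 0 := by
    have h := hdiv θ hθ
    simp_rw [inner_gradient_eq_fderiv_apply] at h
    exact h
  have hθi : Integrable θ volume := hθ.contDiff.continuous.integrable_of_hasCompactSupport hθ.hasCompactSupport
  have hDθc : Continuous (fderiv ℝ θ) := hθ1.continuous_fderiv one_ne_zero
  have hDθcs : HasCompactSupport (fderiv ℝ θ) := hθ.hasCompactSupport.fderiv (𝕜 := ℝ)
  have hDθxi : Integrable (fun x => fderiv ℝ θ x x) volume := by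
    refine Continuous.integrable_of_hasCompactSupport (hDθc.clm_apply continuous_id) ?_
    exact hDθcs.mono fun x hx => by
      intro h0
      apply hx
      change fderiv ℝ θ x x = 0
      rw [h0]; rfl
  have e3 : ∫ x, (fderiv ℝ θ x x + 3 * θ x) = 0 := by
    have h := integral_fderiv_apply_eq_neg_integral_mul_divergence_of_hasCompactSupport
      (v := fun y : EuclideanSpace ℝ (Fin 3) => y) contDiff_id hθ1 hθ.hasCompactSupport
    have hθ3 : ∫ x, θ x * VectorCalculus.divergence (fun y : EuclideanSpace ℝ (Fin 3) => y) x =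
        ∫ x, 3 * θ x :=
      integral_congr_ae (Eventually.of_forall fun x => by
        show θ x * VectorCalculus.divergence (fun y : EuclideanSpace ℝ (Fin 3) => y) x = 3 * θ x
        have hid : VectorCalculus.divergence (fun y : EuclideanSpace ℝ (Fin 3) => y) x = 3 := by
          unfold VectorCalculus.divergence
          rw [show (fun y : EuclideanSpace ℝ (Fin 3) => y) = id from rfl, fderiv_id]
          rw [ContinuousLinearMap.coe_id, LinearMap.trace_id, finrank_euclideanSpace, Fintype.card_fin]
          norm_num
        rw [hid, mul_comm])
    have h3i : Integrable (fun x => 3 * θ x) volume := hθi.const_mul 3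
    calc ∫ x, (fderiv ℝ θ x x + 3 * θ x) = (∫ x, fderiv ℝ θ x x) + ∫ x, 3 * θ x :=
          integral_add hDθxi h3i
      _ = 0 := by rw [h, hθ3]; ring
  -- (D_S) the divergence theorem for `θ · (S y)`: `div (S·) = tr S = 0`
  have hDθSi : Integrable (fun x => fderiv ℝ θ x (S x)) volume := by
    refine Continuous.integrable_of_hasCompactSupport (hDθc.clm_apply S.continuous) ?_
    exact hDθcs.mono fun x hx => by
      intro h0
      apply hx
      change fderiv ℝ θ x (S x) = 0
      rw [h0]; rfl
  have e4 : ∫ x, fderiv ℝ θ x (S x) = 0 := by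
    have h := integral_fderiv_apply_eq_neg_integral_mul_divergence_of_hasCompactSupport
      (v := fun y : EuclideanSpace ℝ (Fin 3) => S y) S.contDiff hθ1 hθ.hasCompactSupport
    have hdivS : ∀ x, VectorCalculus.divergence (fun y : EuclideanSpace ℝ (Fin 3) => S y) x = 0 := by
      intro x
      unfold VectorCalculus.divergence
      rw [show (fun y : EuclideanSpace ℝ (Fin 3) => S y) = (S : EuclideanSpace ℝ (Fin 3) → EuclideanSpace ℝ (Fin 3)) from rfl,
        ContinuousLinearMap.fderiv]
      exact hS0
    rw [h]
    simp [hdivS]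
  -- bounds on `K`
  obtain ⟨MW₀, hMW₀⟩ := hKc.exists_bound_of_continuousOn hWc.continuousOn
  obtain ⟨MDW₀, hMDW₀⟩ := hKc.exists_bound_of_continuousOn hDWc.continuousOn
  set MW : ℝ := max MW₀ 0 with hMWdef
  set MDW : ℝ := max MDW₀ 0 with hMDWdef
  have hMW0 : 0 ≤ MW := le_max_right _ _
  have hMDW0 : 0 ≤ MDW := le_max_right _ _
  have hMW : ∀ x ∈ K, ‖W x‖ ≤ MW := fun x hx => (hMW₀ x hx).trans (le_max_left _ _)
  have hMDW : ∀ x ∈ K, ‖fderiv ℝ W x‖ ≤ MDW := fun x hx => (hMDW₀ x hx).trans (le_max_left _ _)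
  -- `ψ` and its derivative vanish off `K`
  have hψ0 : ∀ x, x ∉ K → ψ x = 0 := fun x hx => image_eq_zero_of_notMem_tsupport fun h => hx (hψK h)
  have hDψ0 : ∀ x, x ∉ K → fderiv ℝ ψ x = 0 := fun x hx =>
    notMem_support.1 fun h => hx (hψK (support_fderiv_subset ℝ h))
  obtain ⟨Cψ, hCψ⟩ := hψ.contDiff.continuous.bounded_above_of_compact_support hψ.hasCompactSupport
  have hDψc : Continuous (fderiv ℝ ψ) := hψ.contDiff.continuous_fderiv (by simp)
  obtain ⟨Cψ', hCψ'⟩ := hDψc.bounded_above_of_compact_support (hψ.hasCompactSupport.fderiv (𝕜 := ℝ))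
  have hCψ0 : 0 ≤ Cψ := (norm_nonneg _).trans (hCψ 0)
  have hCψ'0 : 0 ≤ Cψ' := (norm_nonneg _).trans (hCψ' 0)
  -- the `heq` integrand `t` is integrable
  set t : EuclideanSpace ℝ (Fin 3) → ℝ := fun x =>
    ⟪V x, fderiv ℝ ψ x (V x)⟫ + P x * VectorCalculus.divergence ψ x +
      γ * ⟪V x, fderiv ℝ ψ x x⟫ + ⟪V x, fderiv ℝ ψ x (S x)⟫ + (4 * γ - 1) * ⟪V x, ψ x⟫ + ⟪S (V x), ψ x⟫ with htdef
  have hdivψc : Continuous (VectorCalculus.divergence ψ) :=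
    continuous_divergence_of_contDiff_one (hψ.contDiff.of_le (by exact_mod_cast le_top))
  have hSc : Continuous (fun x : EuclideanSpace ℝ (Fin 3) => S x) := S.continuous
  have htm : AEStronglyMeasurable t volume := by
    refine (((((?_ : AEStronglyMeasurable _ volume).add ?_).add ?_).add ?_).add ?_).add ?_
    · exact hVm.inner (aestronglyMeasurable_clm_apply hDψc.aestronglyMeasurable hVm)
    · exact hPm.mul hdivψc.aestronglyMeasurable
    · exact (hVm.inner (aestronglyMeasurable_clm_apply hDψc.aestronglyMeasurable
        continuous_id.aestronglyMeasurable)).const_mul γ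
    · exact hVm.inner (aestronglyMeasurable_clm_apply hDψc.aestronglyMeasurable hSc.aestronglyMeasurable)
    · exact (hVm.inner hψ.contDiff.continuous.aestronglyMeasurable).const_mul (4 * γ - 1)
    · exact (hSc.comp_aestronglyMeasurable hVm).inner hψ.contDiff.continuous.aestronglyMeasurable
  have hti : Integrable t volume := by
    refine integrable_of_abs_le_on hKm htm hqK
      (C := Cψ' + Cσ' * MW + |γ| * Cψ' * R + Cψ' * (‖S‖ * R) + |4 * γ - 1| * Cψ + ‖S‖ * Cψ)
      (fun x hx => ?_) (fun x hx => ?_)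
    · have hq0 : 0 ≤ ‖V x‖ ^ 2 + |P x| + ‖V x‖ := by positivity
      rw [abs_of_nonneg hq0]
      have hin : ∀ a b : EuclideanSpace ℝ (Fin 3), |⟪a, b⟫| ≤ ‖a‖ * ‖b‖ := fun a b => abs_real_inner_le_norm a b
      have b1 : |⟪V x, fderiv ℝ ψ x (V x)⟫| ≤ Cψ' * ‖V x‖ ^ 2 := by
        refine (hin _ _).trans ?_
        have : ‖fderiv ℝ ψ x (V x)‖ ≤ Cψ' * ‖V x‖ :=
          ((fderiv ℝ ψ x).le_opNorm _).trans (mul_le_mul_of_nonneg_right (hCψ' x) (norm_nonneg _))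
        calc ‖V x‖ * ‖fderiv ℝ ψ x (V x)‖ ≤ ‖V x‖ * (Cψ' * ‖V x‖) :=
              mul_le_mul_of_nonneg_left this (norm_nonneg _)
          _ = Cψ' * ‖V x‖ ^ 2 := by ring
      have b2 : |P x * VectorCalculus.divergence ψ x| ≤ Cσ' * MW * |P x| := by
        rw [abs_mul, hdivψ x]
        have : |fderiv ℝ σ x (W x)| ≤ Cσ' * MW := by
          refine (Real.norm_eq_abs _ ▸ (fderiv ℝ σ x).le_opNorm _).trans ?_
          exact mul_le_mul (hCσ' x) (hMW x hx) (norm_nonneg _) hCσ'0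
        calc |P x| * |fderiv ℝ σ x (W x)| ≤ |P x| * (Cσ' * MW) :=
              mul_le_mul_of_nonneg_left this (abs_nonneg _)
          _ = Cσ' * MW * |P x| := by ring
      have b3 : |γ * ⟪V x, fderiv ℝ ψ x x⟫| ≤ |γ| * Cψ' * R * ‖V x‖ := by
        rw [abs_mul]
        have : ‖fderiv ℝ ψ x x‖ ≤ Cψ' * R :=
          ((fderiv ℝ ψ x).le_opNorm _).trans (mul_le_mul (hCψ' x) (hxK x hx) (norm_nonneg _) hCψ'0)
        calc |γ| * |⟪V x, fderiv ℝ ψ x x⟫| ≤ |γ| * (‖V x‖ * (Cψ' * R)) :=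
              mul_le_mul_of_nonneg_left ((hin _ _).trans (mul_le_mul_of_nonneg_left this (norm_nonneg _)))
                (abs_nonneg _)
          _ = |γ| * Cψ' * R * ‖V x‖ := by ring
      have b4 : |(4 * γ - 1) * ⟪V x, ψ x⟫| ≤ |4 * γ - 1| * Cψ * ‖V x‖ := by
        rw [abs_mul]
        calc |4 * γ - 1| * |⟪V x, ψ x⟫| ≤ |4 * γ - 1| * (‖V x‖ * Cψ) :=
              mul_le_mul_of_nonneg_left ((hin _ _).trans (mul_le_mul_of_nonneg_left (hCψ x) (norm_nonneg _)))
                (abs_nonneg _)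
          _ = |4 * γ - 1| * Cψ * ‖V x‖ := by ring
      have hSx : ‖S x‖ ≤ ‖S‖ * R := (S.le_opNorm x).trans (mul_le_mul_of_nonneg_left (hxK x hx) (norm_nonneg _))
      have b5 : |⟪V x, fderiv ℝ ψ x (S x)⟫| ≤ Cψ' * (‖S‖ * R) * ‖V x‖ := by
        have : ‖fderiv ℝ ψ x (S x)‖ ≤ Cψ' * (‖S‖ * R) :=
          ((fderiv ℝ ψ x).le_opNorm _).trans (mul_le_mul (hCψ' x) hSx (norm_nonneg _) hCψ'0)
        calc |⟪V x, fderiv ℝ ψ x (S x)⟫| ≤ ‖V x‖ * (Cψ' * (‖S‖ * R)) :=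
              (hin _ _).trans (mul_le_mul_of_nonneg_left this (norm_nonneg _))
          _ = Cψ' * (‖S‖ * R) * ‖V x‖ := by ring
      have b6 : |⟪S (V x), ψ x⟫| ≤ ‖S‖ * Cψ * ‖V x‖ := by
        calc |⟪S (V x), ψ x⟫| ≤ ‖S (V x)‖ * ‖ψ x‖ := hin _ _
          _ ≤ (‖S‖ * ‖V x‖) * Cψ := mul_le_mul (S.le_opNorm _) (hCψ x) (norm_nonneg _) (by positivity)
          _ = ‖S‖ * Cψ * ‖V x‖ := by ring
      have hV0 : 0 ≤ ‖V x‖ := norm_nonneg _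
      have hP0 : 0 ≤ |P x| := abs_nonneg _
      have hV20 : 0 ≤ ‖V x‖ ^ 2 := by positivity
      calc |t x| ≤ |⟪V x, fderiv ℝ ψ x (V x)⟫| + |P x * VectorCalculus.divergence ψ x| +
            |γ * ⟪V x, fderiv ℝ ψ x x⟫| + |⟪V x, fderiv ℝ ψ x (S x)⟫| + |(4 * γ - 1) * ⟪V x, ψ x⟫| +
            |⟪S (V x), ψ x⟫| := by
            simp only [htdef]
            refine (abs_add_le _ _).trans (add_le_add ((abs_add_le _ _).trans (add_le_add ((abs_add_le _ _).trans
              (add_le_add ((abs_add_le _ _).trans (add_le_add (abs_add_le _ _) le_rfl)) le_rfl)) le_rfl)) le_rfl)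
        _ ≤ Cψ' * ‖V x‖ ^ 2 + Cσ' * MW * |P x| + |γ| * Cψ' * R * ‖V x‖ + Cψ' * (‖S‖ * R) * ‖V x‖ +
            |4 * γ - 1| * Cψ * ‖V x‖ + ‖S‖ * Cψ * ‖V x‖ := by
            linarith
        _ ≤ (Cψ' + Cσ' * MW + |γ| * Cψ' * R + Cψ' * (‖S‖ * R) + |4 * γ - 1| * Cψ + ‖S‖ * Cψ) *
              (‖V x‖ ^ 2 + |P x| + ‖V x‖) := by
            have h1 : Cψ' * ‖V x‖ ^ 2 ≤ Cψ' * (‖V x‖ ^ 2 + |P x| + ‖V x‖) :=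
              mul_le_mul_of_nonneg_left (by linarith) hCψ'0
            have h2 : Cσ' * MW * |P x| ≤ Cσ' * MW * (‖V x‖ ^ 2 + |P x| + ‖V x‖) :=
              mul_le_mul_of_nonneg_left (by linarith) (by positivity)
            have h3 : |γ| * Cψ' * R * ‖V x‖ ≤ |γ| * Cψ' * R * (‖V x‖ ^ 2 + |P x| + ‖V x‖) :=
              mul_le_mul_of_nonneg_left (by linarith) (by positivity)
            have h4 : |4 * γ - 1| * Cψ * ‖V x‖ ≤ |4 * γ - 1| * Cψ * (‖V x‖ ^ 2 + |P x| + ‖V x‖) :=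
              mul_le_mul_of_nonneg_left (by linarith) (by positivity)
            have h5 : Cψ' * (‖S‖ * R) * ‖V x‖ ≤ Cψ' * (‖S‖ * R) * (‖V x‖ ^ 2 + |P x| + ‖V x‖) :=
              mul_le_mul_of_nonneg_left (by linarith) (by positivity)
            have h6 : ‖S‖ * Cψ * ‖V x‖ ≤ ‖S‖ * Cψ * (‖V x‖ ^ 2 + |P x| + ‖V x‖) :=
              mul_le_mul_of_nonneg_left (by linarith) (by positivity)
            linarith
    · simp [htdef, hψ0 x hx, hDψ0 x hx, hdivψ x, hDσK x hx]
  -- `a = Dθ(V)` is integrable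
  have hai : Integrable (fun x => fderiv ℝ θ x (V x)) volume := by
    refine integrable_of_abs_le_on hKm (aestronglyMeasurable_clm_apply hDθc.aestronglyMeasurable hVm) hV1K
      (C := 1 / 2 * Cσ' * MW ^ 2 + Cσ * (MW * MDW)) (fun x hx => ?_) (fun x hx => ?_)
    · rw [hDθ x (V x), abs_of_nonneg (norm_nonneg _)]
      have hin : ∀ a b : EuclideanSpace ℝ (Fin 3), |⟪a, b⟫| ≤ ‖a‖ * ‖b‖ := fun a b => abs_real_inner_le_norm a b
      have b1 : |(1 / 2 : ℝ) * (fderiv ℝ σ x (V x) * ‖W x‖ ^ 2)| ≤ 1 / 2 * Cσ' * MW ^ 2 * ‖V x‖ := by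
        rw [abs_mul, abs_mul, abs_of_pos (by norm_num : (0 : ℝ) < 1 / 2), abs_pow, abs_norm]
        have h1 : |fderiv ℝ σ x (V x)| ≤ Cσ' * ‖V x‖ :=
          (Real.norm_eq_abs _ ▸ (fderiv ℝ σ x).le_opNorm _).trans
            (mul_le_mul_of_nonneg_right (hCσ' x) (norm_nonneg _))
        have h2 : ‖W x‖ ^ 2 ≤ MW ^ 2 := pow_le_pow_left₀ (norm_nonneg _) (hMW x hx) 2
        calc (1 / 2 : ℝ) * (|fderiv ℝ σ x (V x)| * ‖W x‖ ^ 2) ≤ (1 / 2 : ℝ) * ((Cσ' * ‖V x‖) * MW ^ 2) :=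
              mul_le_mul_of_nonneg_left (mul_le_mul h1 h2 (by positivity) (by positivity)) (by norm_num)
          _ = _ := by ring
      have b2 : |σ x * ⟪W x, fderiv ℝ W x (V x)⟫| ≤ Cσ * (MW * MDW) * ‖V x‖ := by
        rw [abs_mul]
        have h1 : ‖fderiv ℝ W x (V x)‖ ≤ MDW * ‖V x‖ :=
          ((fderiv ℝ W x).le_opNorm _).trans (mul_le_mul_of_nonneg_right (hMDW x hx) (norm_nonneg _))
        have h2 : |⟪W x, fderiv ℝ W x (V x)⟫| ≤ MW * (MDW * ‖V x‖) :=
          (hin _ _).trans (mul_le_mul (hMW x hx) h1 (norm_nonneg _) hMW0)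
        calc |σ x| * |⟪W x, fderiv ℝ W x (V x)⟫| ≤ Cσ * (MW * (MDW * ‖V x‖)) :=
              mul_le_mul ((Real.norm_eq_abs _).symm.le.trans (hCσ x)) h2 (abs_nonneg _) hCσ0
          _ = _ := by ring
      calc |(1 / 2 : ℝ) * (fderiv ℝ σ x (V x) * ‖W x‖ ^ 2) + σ x * ⟪W x, fderiv ℝ W x (V x)⟫|
          ≤ _ := abs_add_le _ _
        _ ≤ 1 / 2 * Cσ' * MW ^ 2 * ‖V x‖ + Cσ * (MW * MDW) * ‖V x‖ := add_le_add b1 b2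
        _ = (1 / 2 * Cσ' * MW ^ 2 + Cσ * (MW * MDW)) * ‖V x‖ := by ring
    · rw [hDθ x (V x), hσK x hx, hDσK x hx]
      simp
  have hbi : Integrable (fun x => fderiv ℝ θ x x + 3 * θ x) volume := hDθxi.add (hθi.const_mul 3)
  -- the pointwise identity and the conclusion
  have hpt : ∀ x, ((fderiv ℝ σ x) (V x) * ⟪(V x), (W x)⟫ + (σ x) * ⟪(V x), (fderiv ℝ W x) (V x)⟫ + (P x) * (fderiv ℝ σ x) (W x) +
          γ * ((fderiv ℝ σ x) x * ⟪(V x), (W x)⟫ + (σ x) * ⟪(V x), (fderiv ℝ W x) x⟫) + (4 * γ - 1) * ((σ x) * ⟪(V x), (W x)⟫) -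
          ((1 / 2 : ℝ) * ((fderiv ℝ σ x) (V x) * ‖(W x)‖ ^ 2) + (σ x) * ⟪(W x), (fderiv ℝ W x) (V x)⟫) -
          γ * ((1 / 2 : ℝ) * ((fderiv ℝ σ x) x * ‖(W x)‖ ^ 2) + (σ x) * ⟪(W x), (fderiv ℝ W x) x⟫ + 3 * ((1 / 2 : ℝ) * ((σ x) * ‖(W x)‖ ^ 2)))) +
          (((fderiv ℝ σ x) (S x) * ⟪(V x), (W x)⟫ + (σ x) * ⟪(V x), (fderiv ℝ W x) (S x)⟫ + (σ x) * ⟪S (V x), (W x)⟫) -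
            ((1 / 2 : ℝ) * ((fderiv ℝ σ x) (S x) * ‖(W x)‖ ^ 2) + (σ x) * ⟪(W x), (fderiv ℝ W x) (S x)⟫)) = t x - fderiv ℝ θ x (V x) - γ * (fderiv ℝ θ x x + 3 * θ x) - fderiv ℝ θ x (S x) := by
    intro x
    simp only [htdef, hDψ, hdivψ, hDθ, hψx, hθx, inner_add_right, real_inner_smul_right]
    ring
  have hsub : Integrable (fun x => t x - fderiv ℝ θ x (V x)) volume := hti.sub hai
  have hcm : Integrable (fun x => γ * (fderiv ℝ θ x x + 3 * θ x)) volume := hbi.const_mul γ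
  refine ⟨?_, ?_⟩
  · have h : Integrable (fun x => t x - fderiv ℝ θ x (V x) - γ * (fderiv ℝ θ x x + 3 * θ x) -
        fderiv ℝ θ x (S x)) volume :=
      (hsub.sub hcm).sub hDθSi
    exact (integrable_congr (Eventually.of_forall hpt)).2 h
  calc ∫ x, ((fderiv ℝ σ x) (V x) * ⟪(V x), (W x)⟫ + (σ x) * ⟪(V x), (fderiv ℝ W x) (V x)⟫ + (P x) * (fderiv ℝ σ x) (W x) +
          γ * ((fderiv ℝ σ x) x * ⟪(V x), (W x)⟫ + (σ x) * ⟪(V x), (fderiv ℝ W x) x⟫) + (4 * γ - 1) * ((σ x) * ⟪(V x), (W x)⟫) -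
          ((1 / 2 : ℝ) * ((fderiv ℝ σ x) (V x) * ‖(W x)‖ ^ 2) + (σ x) * ⟪(W x), (fderiv ℝ W x) (V x)⟫) -
          γ * ((1 / 2 : ℝ) * ((fderiv ℝ σ x) x * ‖(W x)‖ ^ 2) + (σ x) * ⟪(W x), (fderiv ℝ W x) x⟫ + 3 * ((1 / 2 : ℝ) * ((σ x) * ‖(W x)‖ ^ 2)))) +
          (((fderiv ℝ σ x) (S x) * ⟪(V x), (W x)⟫ + (σ x) * ⟪(V x), (fderiv ℝ W x) (S x)⟫ + (σ x) * ⟪S (V x), (W x)⟫) -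
            ((1 / 2 : ℝ) * ((fderiv ℝ σ x) (S x) * ‖(W x)‖ ^ 2) + (σ x) * ⟪(W x), (fderiv ℝ W x) (S x)⟫)) = ∫ x, (t x - fderiv ℝ θ x (V x) - γ * (fderiv ℝ θ x x + 3 * θ x) - fderiv ℝ θ x (S x)) :=
        integral_congr_ae (Eventually.of_forall hpt)
    _ = (∫ x, t x) - (∫ x, fderiv ℝ θ x (V x)) - γ * (∫ x, (fderiv ℝ θ x x + 3 * θ x)) -
          ∫ x, fderiv ℝ θ x (S x) := by
        have hscm : Integrable (fun x => t x - fderiv ℝ θ x (V x) - γ * (fderiv ℝ θ x x + 3 * θ x)) volume :=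
          hsub.sub hcm
        rw [integral_sub hscm hDθSi, integral_sub hsub hcm, integral_sub hti hai, integral_const_mul]
    _ = 0 := by
        have ht0 : ∫ x, t x = 0 := e1
        rw [ht0, e2, e3, e4]
        ring



end Spiral

end Summit.NavierStokesRegularity.NavierStokesRegularity.Theorems.PowerGaugeEulerLiouville
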